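import Mathlib
import Summits.Ventures.PercRepro2.Defs
import Summits.Ventures.PercRepro2.Graph
import Summits.Ventures.PercRepro2.HullDefs
import Summits.Ventures.PercRepro2.LocRows
import Summits.Ventures.PercRepro2.SwRow

/-!
# Two parallel edges: the deleted and the merged graph (blind cell PercRepro2, night-4 g5,
2026-08-24; proofs/NIGHT4-BRIDGE.md §4)

Two parallel edges `e`, `e'` between `u ≠ v`.  By their colours `Q(G)` splits into the same-colour
part, which is `Q(G − e')` (the pair acts as the single edge `e`), and the mixed part, which is
`Q(G / {u = v}) × {RB, BR}` (`u` and `v` are joined in both colours).  The merged graph lives on the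
same vertex type: `v` is renamed to `u` in every remaining edge (`mergeEnds`), and the marks are
renamed alike.  This file holds the vocabulary and the cluster correspondences (`cluster_same_eq`,
`mem_cluster_mixed_iff`); the reduction of row 2′SW-ALL itself (`swAll_parallel`) is the next file.
-/

namespace Summit.Ventures.PercRepro2

namespace Parallel

open Hull LocRows

open scoped Classical

variable {V : Type*} {E : Type*}

/-- Two parallel edges `e ≠ e'` with ends `{u, v}`, `u ≠ v`. -/
structure IsParallel (ends : E → Sym2 V) (u v : V) (e e' : E) : Prop where
  /-- `e = {u, v}`. -/
  ends_e : ends e = s(u, v)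
  /-- `e' = {u, v}`. -/
  ends_e' : ends e' = s(u, v)
  /-- The edges are distinct. -/
  ne : e ≠ e'
  /-- `u ≠ v`. -/
  uv : u ≠ v

variable {ends : E → Sym2 V} {u v : V} {e e' : E}

/-- The edges of `G − e'`. -/
abbrev DelE (e' : E) : Type _ := {x : E // x ≠ e'}

/-- The incidence map of `G − e'`. -/
def delEnds (ends : E → Sym2 V) (e' : E) : DelE e' → Sym2 V := fun x => ends x.1

/-- The restriction of a configuration to `G − e'`. -/
def delConfig (ζ : Config E) : Config (DelE e') := fun x => ζ x.1

/-- The renaming `v ↦ u`. -/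
noncomputable def rename (u v : V) : V → V := fun x => if x = v then u else x

/-- The edges of the merged graph `G / {u = v}`: all edges but `e`, `e'`. -/
abbrev MergeE (e e' : E) : Type _ := {x : E // x ≠ e ∧ x ≠ e'}

/-- The incidence map of the merged graph: `v` renamed to `u`. -/
noncomputable def mergeEnds (ends : E → Sym2 V) (u v : V) (e e' : E) : MergeE e e' → Sym2 V :=
  fun x => (ends x.1).map (rename u v)

/-- The restriction of a configuration to the merged graph. -/
def mergeConfig (ζ : Config E) : Config (MergeE e e') := fun x => ζ x.1

/-- The restriction commutes with the colour swap. -/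
lemma delConfig_blue (ζ : Config E) : delConfig (e' := e') (blue ζ) = blue (delConfig ζ) := rfl

/-- The merged restriction commutes with the colour swap. -/
lemma mergeConfig_blue (ζ : Config E) :
    mergeConfig (e := e) (e' := e') (blue ζ) = blue (mergeConfig ζ) := rfl

/-- `rename` identifies exactly `u` and `v`. -/
lemma rename_eq_iff {a b : V} :
    rename u v a = rename u v b ↔ a = b ∨ (a = u ∧ b = v) ∨ (a = v ∧ b = u) := by
  unfold rename
  split_ifs with ha hb hb
  · exact ⟨fun _ => Or.inl (ha.trans hb.symm), fun _ => rfl⟩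
  · constructor
    · intro h; exact Or.inr (Or.inr ⟨ha, h.symm⟩)
    · rintro (h | ⟨_, h⟩ | ⟨_, h⟩)
      · exact absurd (ha.symm.trans h).symm hb
      · exact absurd h hb
      · exact h.symm
  · constructor
    · intro h; exact Or.inr (Or.inl ⟨h, hb⟩)
    · rintro (h | ⟨h, _⟩ | ⟨h, _⟩)
      · exact absurd (h.trans hb) ha
      · exact h
      · exact absurd h ha
  · constructor
    · intro h; exact Or.inl h
    · rintro (h | ⟨_, h⟩ | ⟨h, _⟩)
      · exact h
      · exact absurd h hb
      · exact absurd h ha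

/-- `u ∈ C(v) ↔ v ∈ C(u)`. -/
lemma mem_cluster_comm_par {ω : Config E} {a b : V} :
    a ∈ cluster ends ω b ↔ b ∈ cluster ends ω a := by
  simp only [mem_cluster]; exact ⟨conn_symm, conn_symm⟩

/-- `rename v = u`. -/
lemma rename_v : rename u v v = u := by simp [rename]

/-- `rename u = u`. -/
lemma rename_u : rename u v u = u := by simp [rename]

/-! ## The same-colour case -/

/-- With `e`, `e'` of the same colour, the clusters of `G` are those of `G − e'`. -/
theorem cluster_same_eq (hp : IsParallel ends u v e e') {ζ : Config E} (hs : ζ e = ζ e') (x : V) :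
    cluster ends ζ x = cluster (delEnds ends e') (delConfig ζ) x := by
  apply Set.Subset.antisymm
  · intro y hy
    refine mem_of_conn_of_closed (ends := ends) (ω := ζ) ?_ (mem_cluster_self _ _ _) hy
    intro a ha b hab
    obtain ⟨hne, f, hf, hends⟩ := openGraph_adj.1 hab
    by_cases hfe : f = e'
    · -- the edge `e'`: use `e` instead
      subst hfe
      refine mem_cluster_of_adj ha (openGraph_adj.2 ⟨hne, ⟨e, hp.ne⟩, ?_, ?_⟩)
      · show ζ e = true; rw [hs]; exact hf
      · show ends e = s(a, b); rw [hp.ends_e, ← hp.ends_e']; exact hends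
    · exact mem_cluster_of_adj ha (openGraph_adj.2 ⟨hne, ⟨f, hfe⟩, hf, hends⟩)
  · intro y hy
    refine mem_of_conn_of_closed (ends := delEnds ends e') (ω := delConfig ζ) ?_
      (mem_cluster_self _ _ _) hy
    intro a ha b hab
    obtain ⟨hne, f, hf, hends⟩ := openGraph_adj.1 hab
    exact mem_cluster_of_adj ha (openGraph_adj.2 ⟨hne, f.1, hf, hends⟩)

/-! ## The mixed case -/

/-- A red edge of `G` other than `e`, `e'` gives a red adjacency of the merged graph between the
renamed ends. -/
lemma adj_merge_of_edge {ζ : Config E} {f : E} (h₁ : f ≠ e) (h₂ : f ≠ e') (hf : ζ f = true)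
    {a b : V} (hends : ends f = s(a, b)) (hne : rename u v a ≠ rename u v b) :
    (openGraph (mergeEnds ends u v e e') (mergeConfig ζ)).Adj (rename u v a) (rename u v b) := by
  refine openGraph_adj.2 ⟨hne, ⟨f, h₁, h₂⟩, hf, ?_⟩
  show (ends f).map (rename u v) = s(rename u v a, rename u v b)
  rw [hends, Sym2.map_mk]

/-- In the mixed case (one of `e`, `e'` red) the red clusters of `G` are the preimages of those of the
merged graph under the renaming. -/
theorem mem_cluster_mixed_iff (hp : IsParallel ends u v e e') {ζ : Config E}
    (hmix : ζ e = true ∨ ζ e' = true) (x y : V) :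
    y ∈ cluster ends ζ x ↔
      rename u v y ∈ cluster (mergeEnds ends u v e e') (mergeConfig (e := e) (e' := e') ζ) (rename u v x) := by
  -- `u ↔ v` in `G`
  have huv : v ∈ cluster ends ζ u := by
    rcases hmix with h | h
    · exact mem_cluster_of_edge (ends := ends) (mem_cluster_self _ _ _) (e := e) h hp.ends_e
    · exact mem_cluster_of_edge (ends := ends) (mem_cluster_self _ _ _) (e := e') h hp.ends_e'
  -- vertices with the same name are in the same cluster of `G`
  have hsame : ∀ a b : V, rename u v a = rename u v b → b ∈ cluster ends ζ a := by
    intro a b hab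
    rcases rename_eq_iff.1 hab with h | ⟨rfl, rfl⟩ | ⟨rfl, rfl⟩
    · rw [h]; exact mem_cluster_self _ _ _
    · exact huv
    · exact mem_cluster_comm_par.1 huv
  constructor
  · intro hy
    refine mem_of_conn_of_closed (ends := ends) (ω := ζ)
      (S := {y | rename u v y ∈ cluster (mergeEnds ends u v e e') (mergeConfig ζ) (rename u v x)})
      ?_ (mem_cluster_self _ _ _) hy
    intro a ha b hab
    obtain ⟨_, f, hf, hends⟩ := openGraph_adj.1 hab
    by_cases hfe : f = e
    · -- the edge `e`: `{a, b} = {u, v}`, same name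
      subst hfe
      rw [hp.ends_e] at hends
      have : rename u v a = rename u v b := by
        rcases Sym2.eq_iff.1 hends with ⟨rfl, rfl⟩ | ⟨rfl, rfl⟩
        · rw [rename_u, rename_v]
        · rw [rename_u, rename_v]
      simp only [Set.mem_setOf_eq] at ha ⊢
      rw [← this]; exact ha
    by_cases hfe' : f = e'
    · subst hfe'
      rw [hp.ends_e'] at hends
      have : rename u v a = rename u v b := by
        rcases Sym2.eq_iff.1 hends with ⟨rfl, rfl⟩ | ⟨rfl, rfl⟩
        · rw [rename_u, rename_v]
        · rw [rename_u, rename_v]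
      simp only [Set.mem_setOf_eq] at ha ⊢
      rw [← this]; exact ha
    · by_cases hne : rename u v a = rename u v b
      · simp only [Set.mem_setOf_eq] at ha ⊢
        rw [← hne]; exact ha
      · simp only [Set.mem_setOf_eq] at ha ⊢
        exact mem_cluster_of_adj ha (adj_merge_of_edge hfe hfe' hf hends hne)
  · intro hy
    -- the image of the cluster of `x` under the renaming is closed in the merged graph
    have key : cluster (mergeEnds ends u v e e') (mergeConfig ζ) (rename u v x) ⊆
        {z | ∃ y', z = rename u v y' ∧ y' ∈ cluster ends ζ x} := by
      intro z hz
      refine mem_of_conn_of_closed (ends := mergeEnds ends u v e e') (ω := mergeConfig ζ) ?_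
        ⟨x, rfl, mem_cluster_self _ _ _⟩ hz
      rintro a ⟨a', rfl, ha'⟩ b hab
      obtain ⟨_, f, hf, hends⟩ := openGraph_adj.1 hab
      -- `ends f = {c, d}` with `{rename c, rename d} = {rename a', b}`
      obtain ⟨c, d, hcd⟩ : ∃ c d, ends f.1 = s(c, d) := by
        induction ends f.1 using Sym2.ind with
        | _ c d => exact ⟨c, d, rfl⟩
      have hmap : s(rename u v c, rename u v d) = s(rename u v a', b) := by
        rw [← Sym2.map_mk, ← hcd]; exact hends
      rcases Sym2.eq_iff.1 hmap with ⟨hca, hdb⟩ | ⟨hcb, hda⟩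
      · -- `c` has the name of `a'`, `b` is the name of `d`
        refine ⟨d, hdb.symm, ?_⟩
        have hc : c ∈ cluster ends ζ x := (hsame a' c hca.symm) |> fun h => by
          exact mem_of_conn_of_closed (ends := ends) (ω := ζ) (S := cluster ends ζ x)
            (fun p hp q hpq => mem_cluster_of_adj hp hpq) ha' h
        exact mem_cluster_of_edge (ends := ends) hc (e := f.1) hf hcd
      · refine ⟨c, hcb.symm, ?_⟩
        have hd : d ∈ cluster ends ζ x := (hsame a' d hda.symm) |> fun h => by
          exact mem_of_conn_of_closed (ends := ends) (ω := ζ) (S := cluster ends ζ x)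
            (fun p hp q hpq => mem_cluster_of_adj hp hpq) ha' h
        exact mem_cluster_of_edge (ends := ends) hd (e := f.1) hf (by rw [hcd, Sym2.eq_swap])
    obtain ⟨y', hy', hy'x⟩ := key hy
    exact mem_of_conn_of_closed (ends := ends) (ω := ζ) (S := cluster ends ζ x)
      (fun p hp q hpq => mem_cluster_of_adj hp hpq) hy'x (hsame y' y hy'.symm)

end Parallel

end Summit.Ventures.PercRepro2
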